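import Summits.SmoothPoincare4.SmoothPoincare4.Theorems.SullivanDualWitnessChargeHelperProperHoloUSC
import Summits.SmoothPoincare4.SmoothPoincare4.Theorems.SullivanDualWitnessChargeHelperProperHoloNLC
import Summits.SmoothPoincare4.SmoothPoincare4.Theorems.SullivanDualWitnessChargeHelperProperHoloGoodIsOpen
import Summits.SmoothPoincare4.SmoothPoincare4.Theorems.SullivanDualWitnessChargeHelperProperHoloBadIsOpen

/-!
# Degree-one proper holomorphic maps are biholomorphic (assembly of the four parts)

Crux `WitnessCharge` (stmt-SmoothPoincare4-7824, route `SullivanDual`), line `Sketch`, registered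
helper `helper_properHolo_degreeOne` (lead, cycle 2).

In Gromov's pencil argument (card `Cruxes/WitnessCharge/Lines/Sketch.md`, (P3)(a)) the flat
coordinate `Z = z ∘ u` of a pencil member, restricted to `U_R = {ξ ∈ u⁻¹(B_ε') | R < |Z ξ|}`, is a
relatively proper holomorphic map onto the exterior `A_R = {R < |z|}` of a disc with a simple
single-point fibre far out; this file turns that into a biholomorphism, using only one-variable
complex analysis (no `J`-curve theory): the set `G ⊆ A` of values with exactly one, simple,
preimage is open (`helper_properHolo_goodIsOpen`, from the inverse function theorem and the upper
semicontinuity of fibres `helper_properHolo_upperSemicontinuous`), its complement in `A` is open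
(`helper_properHolo_badIsOpen`, from the local normal form of holomorphic functions and the fact
that a relatively proper holomorphic map is nowhere locally constant,
`helper_properHolo_notLocallyConstant`), and `G ≠ ∅`; so `G = A` when `A` is preconnected.

Reference for the classical statement: W. Rudin, *Real and complex analysis*, 3rd ed., Thm 10.32
(local mapping degree) and §14 (proper holomorphic maps); O. Forster, *Lectures on Riemann
surfaces*, §4 (proper holomorphic maps have a well-defined degree).
-/

noncomputable section

set_option linter.dupNamespace false

open Set Filter Topology Metric

namespace Summit.SmoothPoincare4.SmoothPoincare4.Theorems.WitnessCharge.PencilIncompleteness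

/-- **A relatively proper holomorphic map with one simple single-point fibre is a
biholomorphism onto its (preconnected) codomain.** Let `U, A ⊆ ℂ` be open, `A` preconnected,
`Z` holomorphic on `U` with `Z(U) ⊆ A`, relatively proper over `A` (`U ∩ Z ⁻¹' K` compact for
every compact `K ⊆ A`), and suppose some `a₀ ∈ A` has exactly one preimage `ξ₀ ∈ U`, at which
`Z' ≠ 0`. Then `Z` maps `U` bijectively onto `A` and `Z' ≠ 0` on `U` (so the inverse is
holomorphic by `helper_holoInverse`). -/
theorem helper_properHolo_degreeOne :
    ∀ (Z : ℂ → ℂ) (U A : Set ℂ), IsOpen U → IsOpen A → IsPreconnected A →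
      DifferentiableOn ℂ Z U → MapsTo Z U A →
      (∀ K ⊆ A, IsCompact K → IsCompact (U ∩ Z ⁻¹' K)) →
      (∃ a₀ ∈ A, ∃ ξ₀ ∈ U, Z ξ₀ = a₀ ∧ deriv Z ξ₀ ≠ 0 ∧ ∀ ξ ∈ U, Z ξ = a₀ → ξ = ξ₀) →
      BijOn Z U A ∧ ∀ ξ ∈ U, deriv Z ξ ≠ 0 := by
  intro Z U A hU hA hAc hZ hZA hprop hgood
  -- the set of values with exactly one, simple, preimage
  set G : Set ℂ := {a ∈ A | ∃ ξ₀ ∈ U, Z ξ₀ = a ∧ deriv Z ξ₀ ≠ 0 ∧ ∀ ξ ∈ U, Z ξ = a → ξ = ξ₀}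
    with hG
  have hUSC := helper_properHolo_upperSemicontinuous Z U A hA hZ.continuousOn hZA hprop
  have hNLC := helper_properHolo_notLocallyConstant Z U A hU hZ hZA hprop
  have hGopen : IsOpen G := helper_properHolo_goodIsOpen Z U A hU hA hZ hZA hUSC
  have hBopen : IsOpen (A \ G) := helper_properHolo_badIsOpen Z U A hU hA hZ hZA hUSC hNLC
  -- `G` is all of `A`, by preconnectedness
  have hGA : A ⊆ G := by
    obtain ⟨a₀, ha₀A, ξ₀, hξ₀U, hZξ₀, hd, huniq⟩ := hgood
    have ha₀G : a₀ ∈ G := ⟨ha₀A, ξ₀, hξ₀U, hZξ₀, hd, huniq⟩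
    by_contra hnot
    obtain ⟨a₁, ha₁A, ha₁G⟩ := not_subset.1 hnot
    have hcover : A ⊆ G ∪ (A \ G) := fun a ha => by
      by_cases h : a ∈ G
      · exact Or.inl h
      · exact Or.inr ⟨ha, h⟩
    obtain ⟨a, _, haG, _, haG'⟩ :=
      hAc G (A \ G) hGopen hBopen hcover ⟨a₀, ha₀A, ha₀G⟩ ⟨a₁, ha₁A, ha₁A, ha₁G⟩
    exact haG' haG
  refine ⟨⟨hZA, ?_, ?_⟩, ?_⟩
  · -- injective
    intro ξ hξ ξ' hξ' heq
    obtain ⟨_, ξ₀, _, _, _, huniq⟩ := hGA (hZA hξ')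
    rw [huniq ξ hξ heq, huniq ξ' hξ' rfl]
  · -- surjective
    intro a ha
    obtain ⟨_, ξ₀, hξ₀U, hZξ₀, _, _⟩ := hGA ha
    exact ⟨ξ₀, hξ₀U, hZξ₀⟩
  · -- no critical points
    intro ξ hξ
    obtain ⟨_, ξ₀, _, _, hd, huniq⟩ := hGA (hZA hξ)
    rw [huniq ξ hξ rfl]
    exact hd

end Summit.SmoothPoincare4.SmoothPoincare4.Theorems.WitnessCharge.PencilIncompleteness
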